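import Summits.QuantumFields.BalabanUV.T4Continuum.Support.NE7EJBracketIntegral

/-!
# NE7EJBracketConvex — row NE7 (node U5), candidate route HOM, variant H1L-EJ: THE MINIMISER SELECTION ALONG THE LINE EXISTS AND IS UNIQUE
# for STRICTLY CONVEX, COERCIVE actions on a closed convex fibre (the finite-dimensional real-slice skeleton of K1-var(s) for the line) —
# so files 106 ∕ 107's letters hold for THE minimisers `U_τ`

Lineage `b2b-balaban-t4-ne7-p2` (CRUX PROVER NE7 #2 = C-HOM°'s kernel hand), generation 80; file 114 (sequel of 106 `NE7EJBracket`, 107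
`NE7EJBracketIntegral`).  Files 106 ∕ 107 take a MINIMISER SELECTION `u : ℝ → X` as a hypothesis (the desk, PRICING-NE7 v44 §326 T-45-7′: «an
`IsMinOn` hypothesis at Bałaban's minimisers is (H∃)-class — a binder, fine»).  In the road the binder is K1-var(s) (ROUTES-NE7 §L1.1 l.32:
«MINIMISERS OF THE LINE. Existence, uniqueness, analyticity in V and exponential quasi-locality of the constrained minimisers of A_s»; desk letter
L; B11 = [Balaban1985Variational] Thm 1 ∕ Prop 9 for the Wilson action).  Its elementary finite-dimensional core — EXISTENCE AND UNIQUENESS on the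
real slice — is convex analysis, typed here abstractly so that the selection of 106 ∕ 107 is DISCHARGED in that setting:
* §1 `eq_of_isMinOn_of_strictConvexOn` — a strictly convex function on a convex set has AT MOST ONE minimiser there (midpoint argument);
  `strictConvexOn_smul_pos` (`c > 0`); **`strictConvexOn_lineF`** — for `τ ∈ [0,1]` the line `A_τ = (1−τ)A_c + τA_B` of two strictly convex
  actions is strictly convex.
* §2 COERCIVITY along the line (`Tendsto f (cocompact ⊓ 𝓟 S) atTop`, no `def … : Prop`): **`coercive_lineF`** (`τ ∈ [0,1]`); `continuousOn_lineF`;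
  **`exists_isMinOn_of_coercive`** (a continuous coercive function on a closed non-empty set of a finite-dimensional space attains its minimum —
  Mathlib's `ContinuousOn.exists_isMinOn'`).
* §3 **`existsUnique_lineMin`** — for every `τ ∈ [0,1]` the line has EXACTLY ONE minimiser on the fibre; `lineArgmin` (the selection by choice),
  `lineArgmin_spec`, `lineArgmin_eq_of_isMinOn`; hence files 106 ∕ 107 BY NAME for THE minimisers: **`bracket_eq_integral_argmin`** ((E1): the bracket of
  the two endpoint minimisers `= ∫₀¹ 𝔇(U_τ) dτ` along the unique minimiser curve), `defect_argmin_antitoneOn` ((E3)), `argmin_sandwich` (EJ-1a).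

HONEST FRAMING: [folklore] convex analysis in a finite-dimensional real normed space; a CARICATURE of K1-var(s): Bałaban's actions are convex only
near flat configurations after gauge fixing (B11's positivity), NOT globally — the global strict convexity + coercivity here is the model
hypothesis, and analyticity ∕ quasi-locality (the rest of K1-var(s), letter L) are untouched; nothing of B11 instantiated; NOT (N1) ∕ EJ-1b's complex
step ∕ EJ-1c ∕ EJ-2 ∕ EJ-3; NOT a letter move.  NE7 NOT PRINTED ∕ NOT PROVED; spine 0∕9; FIXED FINITE T⁴, rung (B)+1; NOT infinite volume, NOT mass
gap, NOT Clay.  HONEST DEPENDENCY: continuum YM on T⁴ ⇐ BetaPertH ∧ nine spine estimates (0/9 proved); BetaPertH ⇐ (D1) ∧ (D4) ∧ CAP+tail; G-an2-4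
gates asym, D1 and NE2/3/4.
-/

noncomputable section

open Set Filter Topology MeasureTheory intervalIntegral

namespace Summit.QuantumFields.BalabanUV.T4Continuum.NE7EJBracketConvex

open NE7EJBracket NE7EJBracketIntegral

/-! ### §1 Strict convexity: at most one minimiser; the line of two strictly convex actions is strictly convex -/

section StrictConvex

variable {V : Type*} [AddCommGroup V] [Module ℝ V] {S : Set V}

/-- **a strictly convex function has at most one minimiser on its convex set** (if `u ≠ v` both minimise, the midpoint does strictly better).
[folklore] -/
theorem eq_of_isMinOn_of_strictConvexOn {f : V → ℝ} (hf : StrictConvexOn ℝ S f) {u v : V} (hu : u ∈ S) (hv : v ∈ S) (hmu : IsMinOn f S u)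
    (hmv : IsMinOn f S v) : u = v := by
  by_contra hne
  have hmid : f ((1/2 : ℝ) • u + (1/2 : ℝ) • v) < (1/2 : ℝ) • f u + (1/2 : ℝ) • f v :=
    hf.2 hu hv hne (by norm_num) (by norm_num) (by norm_num)
  have hmem : (1/2 : ℝ) • u + (1/2 : ℝ) • v ∈ S := hf.1 hu hv (by norm_num) (by norm_num) (by norm_num)
  have h1 := (isMinOn_iff.mp hmu) _ hmem
  have h2 := (isMinOn_iff.mp hmv) _ hmem
  simp only [smul_eq_mul] at hmid
  linarith

/-- a positive multiple of a strictly convex function is strictly convex. [folklore] -/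
theorem strictConvexOn_smul_pos {f : V → ℝ} (hf : StrictConvexOn ℝ S f) {c : ℝ} (hc : 0 < c) : StrictConvexOn ℝ S (fun x => c * f x) := by
  refine ⟨hf.1, fun x hx y hy hxy a b ha hb hab => ?_⟩
  have h := hf.2 hx hy hxy ha hb hab
  simp only [smul_eq_mul] at h ⊢
  nlinarith

/-- **the line of two strictly convex actions is strictly convex** for `τ ∈ [0,1]` (`A_τ = (1−τ)A_c + τA_B`; at the endpoints one summand, inside
both with positive weights). [folklore] -/
theorem strictConvexOn_lineF {Ac AB : V → ℝ} (hA : StrictConvexOn ℝ S Ac) (hB : StrictConvexOn ℝ S AB) {τ : ℝ} (hτ : τ ∈ Icc (0:ℝ) 1) :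
    StrictConvexOn ℝ S (lineF Ac AB τ) := by
  have heq : lineF Ac AB τ = fun u => (1 - τ) * Ac u + τ * AB u := by
    funext u; rw [lineF_eq_convex]
  rw [heq]
  rcases eq_or_lt_of_le hτ.1 with h0 | h0
  · -- τ = 0
    have : (fun u => (1 - τ) * Ac u + τ * AB u) = Ac := by funext u; rw [← h0]; ring
    rw [this]; exact hA
  rcases eq_or_lt_of_le hτ.2 with h1 | h1
  · -- τ = 1
    have : (fun u => (1 - τ) * Ac u + τ * AB u) = AB := by funext u; rw [h1]; ring
    rw [this]; exact hB
  · exact (strictConvexOn_smul_pos hA (sub_pos.mpr h1)).add (strictConvexOn_smul_pos hB h0)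

end StrictConvex

/-! ### §2 Coercivity and existence of minimisers along the line -/

section Coercive

variable {V : Type*} [NormedAddCommGroup V] {S : Set V}

/-- **the line of two coercive actions is coercive** for `τ ∈ [0,1]` (COERCIVE on `S` = `f → +∞` along the co-compact filter restricted to
`S`, i.e. `Tendsto f (cocompact V ⊓ 𝓟 S) atTop`: bounded sublevel sets within `S`). [folklore] -/
theorem coercive_lineF {Ac AB : V → ℝ} (hA : Tendsto Ac (cocompact V ⊓ 𝓟 S) atTop) (hB : Tendsto AB (cocompact V ⊓ 𝓟 S) atTop) {τ : ℝ}
    (hτ : τ ∈ Icc (0:ℝ) 1) : Tendsto (lineF Ac AB τ) (cocompact V ⊓ 𝓟 S) atTop := by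
  rw [tendsto_atTop] at hA hB ⊢
  intro M
  filter_upwards [hA M, hB M] with x hxA hxB
  rw [lineF_eq_convex]
  nlinarith [hτ.1, hτ.2]

/-- the line of two continuous actions is continuous on the fibre. [folklore] -/
theorem continuousOn_lineF {Ac AB : V → ℝ} (hA : ContinuousOn Ac S) (hB : ContinuousOn AB S) (τ : ℝ) :
    ContinuousOn (lineF Ac AB τ) S := by
  have : lineF Ac AB τ = fun u => Ac u + τ * (AB u - Ac u) := by funext u; rfl
  rw [this]
  exact hA.add (continuousOn_const.mul (hB.sub hA))

/-- **EXISTENCE**: a continuous coercive function on a closed non-empty set attains its minimum there (finite dimension makes closed bounded sets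
compact; Mathlib's `ContinuousOn.exists_isMinOn'`). [folklore] -/
theorem exists_isMinOn_of_coercive {f : V → ℝ} (hS : IsClosed S) (hne : S.Nonempty) (hf : ContinuousOn f S)
    (hc : Tendsto f (cocompact V ⊓ 𝓟 S) atTop) : ∃ u ∈ S, IsMinOn f S u := by
  obtain ⟨x₀, hx₀⟩ := hne
  have hev : ∀ᶠ x in cocompact V ⊓ 𝓟 S, f x₀ ≤ f x := by
    rw [tendsto_atTop] at hc
    exact hc (f x₀)
  exact hf.exists_isMinOn' hS hx₀ hev

end Coercive

/-! ### §3 Existence and uniqueness along the line; files 106 ∕ 107 for THE minimisers -/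

section LineArgmin

variable {V : Type*} [NormedAddCommGroup V] [NormedSpace ℝ V] {S : Set V} {Ac AB : V → ℝ}

/-- **EXACTLY ONE MINIMISER AT EVERY POINT OF THE LINE**: for strictly convex, coercive, continuous `A_c`, `A_B` on a closed (convex) non-empty
fibre and `τ ∈ [0,1]`, `A_τ` has a unique minimiser on the fibre. [folklore] -/
theorem existsUnique_lineMin (hS : IsClosed S) (hne : S.Nonempty) (hAc : ContinuousOn Ac S) (hBc : ContinuousOn AB S)
    (hAs : StrictConvexOn ℝ S Ac) (hBs : StrictConvexOn ℝ S AB) (hAco : Tendsto Ac (cocompact V ⊓ 𝓟 S) atTop)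
    (hBco : Tendsto AB (cocompact V ⊓ 𝓟 S) atTop) {τ : ℝ}
    (hτ : τ ∈ Icc (0:ℝ) 1) : ∃! u, u ∈ S ∧ IsMinOn (lineF Ac AB τ) S u := by
  obtain ⟨u, hu, hmin⟩ := exists_isMinOn_of_coercive hS hne (continuousOn_lineF hAc hBc τ) (coercive_lineF hAco hBco hτ)
  refine ⟨u, ⟨hu, hmin⟩, fun v hv => ?_⟩
  exact eq_of_isMinOn_of_strictConvexOn (strictConvexOn_lineF hAs hBs hτ) hv.1 hu hv.2 hmin

open Classical in
/-- THE MINIMISER SELECTION of the line (by choice where it exists; outside `[0,1]` or without the hypotheses an arbitrary point of `S`).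
[folklore] -/
def lineArgmin (Ac AB : V → ℝ) (S : Set V) (hne : S.Nonempty) (τ : ℝ) : V :=
  if h : ∃ u, u ∈ S ∧ IsMinOn (lineF Ac AB τ) S u then Classical.choose h else hne.some

/-- the selection IS a minimiser selection on `[0,1]`. [folklore] -/
theorem lineArgmin_spec (hS : IsClosed S) (hne : S.Nonempty) (hAc : ContinuousOn Ac S) (hBc : ContinuousOn AB S)
    (hAs : StrictConvexOn ℝ S Ac) (hBs : StrictConvexOn ℝ S AB) (hAco : Tendsto Ac (cocompact V ⊓ 𝓟 S) atTop)
    (hBco : Tendsto AB (cocompact V ⊓ 𝓟 S) atTop) {τ : ℝ}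
    (hτ : τ ∈ Icc (0:ℝ) 1) : lineArgmin Ac AB S hne τ ∈ S ∧ IsMinOn (lineF Ac AB τ) S (lineArgmin Ac AB S hne τ) := by
  have h := (existsUnique_lineMin hS hne hAc hBc hAs hBs hAco hBco hτ).exists
  rw [lineArgmin, dif_pos h]
  exact Classical.choose_spec h

/-- and it is THE minimiser: any minimiser of `A_τ` on the fibre equals it. [folklore] -/
theorem lineArgmin_eq_of_isMinOn (hS : IsClosed S) (hne : S.Nonempty) (hAc : ContinuousOn Ac S) (hBc : ContinuousOn AB S)
    (hAs : StrictConvexOn ℝ S Ac) (hBs : StrictConvexOn ℝ S AB) (hAco : Tendsto Ac (cocompact V ⊓ 𝓟 S) atTop)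
    (hBco : Tendsto AB (cocompact V ⊓ 𝓟 S) atTop) {τ : ℝ}
    (hτ : τ ∈ Icc (0:ℝ) 1) {v : V} (hv : v ∈ S) (hmin : IsMinOn (lineF Ac AB τ) S v) : v = lineArgmin Ac AB S hne τ := by
  have h := lineArgmin_spec hS hne hAc hBc hAs hBs hAco hBco hτ
  exact eq_of_isMinOn_of_strictConvexOn (strictConvexOn_lineF hAs hBs hτ) hv h.1 hmin h.2

/-- **(E1) FOR THE MINIMISERS** (file 107 BY NAME): the bracket of THE two endpoint minimisers `U^A`, `U^B` equals `∫₀¹ 𝔇(U_τ) dτ` along THE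
minimiser curve. [folklore] -/
theorem bracket_eq_integral_argmin (hS : IsClosed S) (hne : S.Nonempty) (hAc : ContinuousOn Ac S) (hBc : ContinuousOn AB S)
    (hAs : StrictConvexOn ℝ S Ac) (hBs : StrictConvexOn ℝ S AB) (hAco : Tendsto Ac (cocompact V ⊓ 𝓟 S) atTop)
    (hBco : Tendsto AB (cocompact V ⊓ 𝓟 S) atTop) {uA uB : V} (huA : uA ∈ S)
    (huB : uB ∈ S) (hA : IsMinOn Ac S uA) (hB : IsMinOn AB S uB) :
    bracket Ac AB uA uB = ∫ τ in (0:ℝ)..1, defect Ac AB (lineArgmin Ac AB S hne τ) :=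
  bracket_eq_integral' hA hB huA huB (fun _ hτ => (lineArgmin_spec hS hne hAc hBc hAs hBs hAco hBco hτ).1)
    (fun _ hτ => (lineArgmin_spec hS hne hAc hBc hAs hBs hAco hBco hτ).2)

/-- **(E3) FOR THE MINIMISERS** (file 106 BY NAME): the defect along THE minimiser curve is non-increasing on `[0,1]`. [folklore] -/
theorem defect_argmin_antitoneOn (hS : IsClosed S) (hne : S.Nonempty) (hAc : ContinuousOn Ac S) (hBc : ContinuousOn AB S)
    (hAs : StrictConvexOn ℝ S Ac) (hBs : StrictConvexOn ℝ S AB) (hAco : Tendsto Ac (cocompact V ⊓ 𝓟 S) atTop)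
    (hBco : Tendsto AB (cocompact V ⊓ 𝓟 S) atTop) :
    AntitoneOn (fun τ => defect Ac AB (lineArgmin Ac AB S hne τ)) (Icc (0:ℝ) 1) :=
  defect_antitoneOn (fun _ hτ => (lineArgmin_spec hS hne hAc hBc hAs hBs hAco hBco hτ).1)
    (fun _ hτ => (lineArgmin_spec hS hne hAc hBc hAs hBs hAco hBco hτ).2)

/-- **EJ-1a FOR THE MINIMISERS** (file 106 BY NAME): `𝔇(U_1) ≤ Br(U_0, U_1) ≤ 𝔇(U_0)` for THE endpoint minimisers. [folklore] -/
theorem argmin_sandwich (hS : IsClosed S) (hne : S.Nonempty) (hAc : ContinuousOn Ac S) (hBc : ContinuousOn AB S)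
    (hAs : StrictConvexOn ℝ S Ac) (hBs : StrictConvexOn ℝ S AB) (hAco : Tendsto Ac (cocompact V ⊓ 𝓟 S) atTop)
    (hBco : Tendsto AB (cocompact V ⊓ 𝓟 S) atTop) :
    defect Ac AB (lineArgmin Ac AB S hne 1) ≤ bracket Ac AB (lineArgmin Ac AB S hne 0) (lineArgmin Ac AB S hne 1) ∧
      bracket Ac AB (lineArgmin Ac AB S hne 0) (lineArgmin Ac AB S hne 1) ≤ defect Ac AB (lineArgmin Ac AB S hne 0) := by
  have h0 := lineArgmin_spec hS hne hAc hBc hAs hBs hAco hBco (τ := 0) ⟨le_refl _, zero_le_one⟩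
  have h1 := lineArgmin_spec hS hne hAc hBc hAs hBs hAco hBco (τ := 1) ⟨zero_le_one, le_refl _⟩
  rw [lineF_zero] at h0
  rw [lineF_one] at h1
  exact ⟨defect_le_bracket h0.2 h1.1, bracket_le_defect h1.2 h0.1⟩

end LineArgmin

end Summit.QuantumFields.BalabanUV.T4Continuum.NE7EJBracketConvex

end
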